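/-
Copyright (c) 2026 the pub-hodgecm-mathlib formalisation cell (harness21).  Prover seat hodgecm-mathlib-F0P3a-p05 (g17): road «S3-ram» (LEAD F0P3a-plan (g13); owner
F0P3a-p06 (g15); (Cnt2′) chair F0P3a-p07 (g14)), organ (z1-f) «W-SIDE CURRENCY BRIDGE, RANK 2», brick 2: the centred-token dictionary (generic); 2026-09-02.
-/
import Literature.NumberTheory.Automorphic.UnitaryLatticeTreeFixedCosetStrataDictionary     -- ★ p847316 (this seat, g16): `ncard_fixedBy_quotient_sep_eq_ncard_selfDual_fixed_sep` (any `N`), `map_toLin'_mapGL_stdLattice_le_scaleLattice_iff`; brings `mem_fixedBy_quotient_mk_iff`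
import Literature.NumberTheory.Automorphic.UnitaryLatticeTreeSelfDualTransitiveTwo         -- ★ p848050 (this seat): rank-2 self-dual transitivity, `isSelfDualLattice_stdLattice_two_of_v`
import Literature.NumberTheory.Automorphic.UnitaryLatticeTreeCentralRescalingCountTransport -- ★ p847541 (this seat): central rescaling of the level ∕ square ∕ class tokens, `v_pairing_self_le_one`
import Literature.NumberTheory.Automorphic.UnitaryLatticeTreeFixedVertex                   -- ★ `scaleLattice_scaleLattice`, `scaleLattice_le_self_of_v_le_one`, `scaleLattice_mono`
import HarnessLib

/-!
# The lattice graph of a hermitian space — THE CENTRED-TOKEN DICTIONARY: coset labels `|(g⁻¹γg − c·1)_{ab}| ≤ |r|` and `CLS` of the CENTRED operator `γ − c·1` as lattice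
# tokens of `g·L₀`, their comparison with the plain tokens of `γ − 1` when `|c − 1| ≤ |ϖ|²`, and the coset ↔ lattice dictionary at rank 2 (Kottwitz 1986 §3; Rogawski 1990 §4.9;
# Labesse–Langlands 1979 §2)

Topic `NumberTheory/Automorphic`; namespace `Literature.NumberTheory.Automorphic.UnitaryLatticeTree` (§0 in `Literature.NumberTheory.Automorphic`).  THEOREMS ONLY (no definition,
no instance, no notation, no named fact, no `sorry`); kernel lane `--supports stmt-HodgeConjecture-24833`.  Cell `pub/hodgecm-mathlib` (D-0151), crux H413; road «S3-ram»
(Literature seeding, count-neutral), (T2) G-side organ (Cnt2′), sub-organ **(z1-f)** «W-SIDE CURRENCY BRIDGE, RANK 2» (chair F0P3a-p07 (g14) hand (4)), brick 2 — the GENERIC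
half.  Architect A-p12 (g24)'s ★ (B-i)∕(B-ii) (`Rogawski1990/DepthZeroKappaTransferTypeTwoRamifiedDepthBalls*`, `…ShellClassLaw*`) count rank-2 COSETS `hK⁰` labelled through the
CENTRED monodromy `Y_h − c·1`, `Y_h = E₂(h⁻¹γ₂h)`, `c = ½ tr γ_{2,w}`: the ball `|(Y_h − c·1)_{ab}| ≤ |ϖ^{2j}|`, the shell, and the residual class of `ϖ^{−(2j+1)}·ᵗσ(y)·J·(Y_h − c·1)·y`;
the chair's ★ (z1-e) `ncard_selfDual_fixed_axis_*_eq` wants rank-2 self-dual LATTICES `B` labelled by the PLAIN tokens of ★ p847724 (`LEV(ϖ^j) B := (γ − 1)B ⊆ ϖ^j B`,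
`LEV₂(ϖ³)`, `CLS(c₀) := ∃ y ∈ B, a ∈ 𝒪^×, |ϖ⁻¹⟨y,(γ−1)y⟩ − c₀a²| < 1`).  This file supplies every generic conversion:

* §0 `natCard_setOf_exists_mk_eq_ncard_fixedBy_sep` — (B-i)'s set shape `{x : G ⧸ K | ∃ h, x = ↑h ∧ Q(h⁻¹γh)}` versus the dictionary's `{q ∈ Fix_γ | Q(q.out⁻¹ γ q.out)}`
  (`Q` `K`-conjugation invariant on `K` and forcing membership in `K`).
* §1 CENTRED COSET LABELS AS LATTICE TOKENS OF `g·L₀`: `coe_inv_mul_mul_sub_smul_one_eq_conj` (`g⁻¹γg − c·1 = g⁻¹(γ − c·1)g`),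
  **`forall_v_coe_conj_sub_smul_le_iff_map_le_scaleLattice`** (`|(g⁻¹γg − c·1)_{ab}| ≤ |r| ∀ab ⟺ (γ − c·1)(g·L₀) ⊆ r·(g·L₀)`, ★ `map_toLin'_mapGL_stdLattice_le_scaleLattice_iff`),
  **`exists_integral_class_conj_iff_exists_mem_mapGL_class`** ((B-ii)'s `∃ y ∈ 𝒪^N, a` class token of `s·ᵗσ(y)H(g⁻¹γg − c·1)y` ⟺ the lattice class token of `γ − c·1` on `g·L₀`,
  `g ∈ U(σ,H)`), `forall_v_coe_le_one_of_forall_v_sub_smul_le` (a centred-deep integral-trace element is integral).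
* §2 CENTRED VERSUS PLAIN TOKENS when `|c − 1| ≤ |r|` resp. `≤ |ϖ|²` (★ p847541 central rescaling with `s = 1`): **`map_sub_smul_one_le_scaleLattice_iff_map_sub_one_le`**
  (`LEV_{γ−c}(r) ⟺ LEV_{γ−1}(r)`), `map_sub_smul_one_le_scaleLattice_sq_iff_lev_and_lev` (`LEV_{γ−c}(ϖ²) ⟺ LEV(ϖ) ∧ LEV(ϖ²)` — row `0`),
  `map_sq_sub_smul_one_le_iff_map_sq_sub_one_le` (`LEV₂`, under `LEV(ϖ)`), `v_le_of_v_inv_mul_sub_lt_one`, **`exists_mem_class_sub_smul_one_iff_exists_mem_class_sub_one`**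
  (`CLS_{γ−c}(c₀) ⟺ CLS_{γ−1}(c₀)` on a vertex lattice, `|c₀| ≤ 1`).
* §3 THE DICTIONARY AT RANK 2: **`ncard_fixedBy_quotient_sep_eq_ncard_selfDual_fixed_sep_antidiagonal_two`** (`#{uK_U ∈ Fix_γ(U₂ ⧸ K_U) : P} = #{B self-dual for J₂, γB = B, Q B}`,
  `|2| = 1`, via ★ p848050).

HONEST LABEL: HC_CM is proved only modulo the 2 remaining named inputs (hLiu418 24832, h413 24833) until rung 0 closes; elementary lattice algebra, no books consequence.
-/

set_option autoImplicit false

noncomputable section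

open Matrix Literature.NumberTheory.Automorphic Literature.NumberTheory.Automorphic.IntegralReduction Literature.GroupTheory.SpecificGroups
open Literature.NumberTheory.Automorphic.HermitianLattice Literature.NumberTheory.Automorphic.UnitaryGroup
open scoped Matrix MatrixGroups WithZero Valued

/-! ## §0 The set shape of a labelled fixed-coset count -/

namespace Literature.NumberTheory.Automorphic

/-- **(B-i)'s SET SHAPE IS THE DICTIONARY'S**: for a label `Q` that is invariant under `K`-conjugation on `K` and forces membership in `K`,
`#{x : G ⧸ K | ∃ h, x = hK ∧ Q(h⁻¹γh)} = #{q ∈ Fix_γ(G ⧸ K) : Q(q.out⁻¹ γ q.out)}` (the same set). [cite: Kottwitz1986, §3] [cite: LabesseLanglands1979, §2 Lemma 2.1 p. 8] -/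
theorem natCard_setOf_exists_mk_eq_ncard_fixedBy_sep {G : Type*} [Group G] (K : Subgroup G) (γ : G) (Q : G → Prop)
    (hQK : ∀ k ∈ K, ∀ x ∈ K, (Q (k⁻¹ * x * k) ↔ Q x)) (hQmem : ∀ x, Q x → x ∈ K) :
    Nat.card {x : G ⧸ K | ∃ h : G, x = (h : G ⧸ K) ∧ Q (h⁻¹ * γ * h)} =
      {q : G ⧸ K | q ∈ MulAction.fixedBy (G ⧸ K) γ ∧ Q (q.out⁻¹ * γ * q.out)}.ncard := by
  rw [Nat.card_coe_set_eq]
  congr 1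
  ext x
  constructor
  · rintro ⟨h, rfl, hQ⟩
    have hmem : h⁻¹ * γ * h ∈ K := hQmem _ hQ
    obtain ⟨k, hk⟩ := QuotientGroup.mk_out_eq_mul K h
    refine ⟨(mem_fixedBy_quotient_mk_iff K γ h).2 hmem, ?_⟩
    rw [hk, _root_.mul_inv_rev, show (k : G)⁻¹ * h⁻¹ * γ * (h * k) = (k : G)⁻¹ * (h⁻¹ * γ * h) * k by group]
    exact (hQK k k.2 _ hmem).2 hQ
  · rintro ⟨-, hQ⟩
    exact ⟨x.out, (QuotientGroup.out_eq' x).symm, hQ⟩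

end Literature.NumberTheory.Automorphic

namespace Literature.NumberTheory.Automorphic.UnitaryLatticeTree

variable {K : Type*} [Field K] [Valued K ℤᵐ⁰] {N : ℕ}

/-! ## §1 Centred coset labels as lattice tokens of `g·L₀` -/

omit [Valued K ℤᵐ⁰] in
/-- `g⁻¹γg − c·1 = g⁻¹ (γ − c·1) g`. [cite: Kottwitz1986, §3] -/
theorem coe_inv_mul_mul_sub_smul_one_eq_conj (γ g : GL (Fin N) K) (c : K) :
    (((g⁻¹ * γ * g : GL (Fin N) K)) : Matrix (Fin N) (Fin N) K) - c • (1 : Matrix (Fin N) (Fin N) K) =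
      (g : Matrix (Fin N) (Fin N) K)⁻¹ * ((γ : Matrix (Fin N) (Fin N) K) - c • (1 : Matrix (Fin N) (Fin N) K)) * (g : Matrix (Fin N) (Fin N) K) := by
  rw [Units.val_mul, Units.val_mul, Matrix.coe_units_inv, Matrix.mul_sub, Matrix.sub_mul, Matrix.mul_smul, Matrix.smul_mul, Matrix.mul_one,
    Matrix.nonsing_inv_mul _ (Matrix.isUnits_det_units g)]

/-- **THE CENTRED BALL LABEL IS A LEVEL TOKEN**: `|(g⁻¹γg − c·1)_{ab}| ≤ |r|` for all `a, b` iff `(γ − c·1)·(g·L₀) ⊆ r·(g·L₀)` (`r ≠ 0`). [cite: Kottwitz1986, §3]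
[cite: LabesseLanglands1979, §2 Lemma 2.1 p. 8] -/
theorem forall_v_coe_conj_sub_smul_le_iff_map_le_scaleLattice {r : K} (hr : r ≠ 0) (γ g : GL (Fin N) K) (c : K) :
    (∀ a b, Valued.v (((((g⁻¹ * γ * g : GL (Fin N) K)) : Matrix (Fin N) (Fin N) K) - c • (1 : Matrix (Fin N) (Fin N) K)) a b) ≤ Valued.v r) ↔
      (mapGL g (stdLattice K N)).map ((Matrix.toLin' ((γ : Matrix (Fin N) (Fin N) K) - c • (1 : Matrix (Fin N) (Fin N) K))).restrictScalars 𝒪[K]) ≤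
        scaleLattice r (mapGL g (stdLattice K N)) := by
  rw [map_toLin'_mapGL_stdLattice_le_scaleLattice_iff hr, ← coe_inv_mul_mul_sub_smul_one_eq_conj]

omit [Valued K ℤᵐ⁰] in
/-- `(γ − c·1)·(g y) = g·((g⁻¹γg − c·1) y)`. [cite: Kottwitz1986, §3] -/
theorem sub_smul_one_mulVec_coe_mulVec (γ g : GL (Fin N) K) (c : K) (y : Fin N → K) :
    ((γ : Matrix (Fin N) (Fin N) K) - c • (1 : Matrix (Fin N) (Fin N) K)) *ᵥ ((g : Matrix (Fin N) (Fin N) K) *ᵥ y) =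
      (g : Matrix (Fin N) (Fin N) K) *ᵥ (((((g⁻¹ * γ * g : GL (Fin N) K)) : Matrix (Fin N) (Fin N) K) - c • (1 : Matrix (Fin N) (Fin N) K)) *ᵥ y) := by
  rw [coe_inv_mul_mul_sub_smul_one_eq_conj, Matrix.mulVec_mulVec, Matrix.mulVec_mulVec, Matrix.mul_assoc,
    Matrix.mul_nonsing_inv_cancel_left _ _ (Matrix.isUnits_det_units g)]

/-- **(B-ii)'s CLASS LABEL IS THE LATTICE CLASS TOKEN**: for `g ∈ U(σ, H)`, «`∃ y ∈ 𝒪^N, a ∈ 𝒪^×` with `|s·ᵗσ(y)·H·(g⁻¹γg − c·1)·y − c₀a²| < 1`» iff «`∃ y₂ ∈ g·L₀, a ∈ 𝒪^×` with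
`|s·⟨y₂, (γ − c·1)y₂⟩_H − c₀a²| < 1`» (`y₂ = g·y`, `⟨gy, gz⟩ = ⟨y, z⟩`). [cite: Rogawski1990, §4.9 p. 55] [cite: Kottwitz1986, §3] -/
theorem exists_integral_class_conj_iff_exists_mem_mapGL_class (σ : K →+* K) (H : Matrix (Fin N) (Fin N) K) {g : GL (Fin N) K}
    (hg : g ∈ unitaryGroupOfForm σ H) (γ : GL (Fin N) K) (c s c₀ : K) :
    (∃ (y : Fin N → K) (a : K), (∀ i, Valued.v (y i) ≤ 1) ∧ Valued.v a = 1 ∧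
        Valued.v (s * ((fun i => σ (y i)) ⬝ᵥ (H *ᵥ ((((((g⁻¹ * γ * g : GL (Fin N) K)) : Matrix (Fin N) (Fin N) K) - c • (1 : Matrix (Fin N) (Fin N) K))) *ᵥ y))) - c₀ * a ^ 2) < 1) ↔
      ∃ y₂ ∈ mapGL g (stdLattice K N), ∃ a : K, Valued.v a = 1 ∧
        Valued.v (s * pairing σ H y₂ ((((γ : Matrix (Fin N) (Fin N) K) - c • (1 : Matrix (Fin N) (Fin N) K))) *ᵥ y₂) - c₀ * a ^ 2) < 1 := by
  have key : ∀ y : Fin N → K, pairing σ H ((g : Matrix (Fin N) (Fin N) K) *ᵥ y) ((((γ : Matrix (Fin N) (Fin N) K) - c • (1 : Matrix (Fin N) (Fin N) K))) *ᵥ ((g : Matrix (Fin N) (Fin N) K) *ᵥ y)) =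
      (fun i => σ (y i)) ⬝ᵥ (H *ᵥ ((((((g⁻¹ * γ * g : GL (Fin N) K)) : Matrix (Fin N) (Fin N) K) - c • (1 : Matrix (Fin N) (Fin N) K))) *ᵥ y)) := fun y => by
    rw [sub_smul_one_mulVec_coe_mulVec, pairing_mulVec_mulVec_of_mem_unitary hg, pairing_eq_dotProduct]
  constructor
  · rintro ⟨y, a, hy, ha, hlt⟩
    refine ⟨(g : Matrix (Fin N) (Fin N) K) *ᵥ y, ?_, a, ha, ?_⟩
    · exact Submodule.mem_map.2 ⟨y, (mem_stdLattice).2 hy, rfl⟩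
    · rw [key]; exact hlt
  · rintro ⟨y₂, hy₂, a, ha, hlt⟩
    obtain ⟨y, hy, rfl⟩ := Submodule.mem_map.1 hy₂
    refine ⟨y, a, (mem_stdLattice).1 hy, ha, ?_⟩
    rw [← key]; exact hlt

/-- **A CENTRED-DEEP ELEMENT WITH INTEGRAL CENTRE IS INTEGRAL**: `|(X − c·1)_{ab}| ≤ |r| ≤ 1` and `|c| ≤ 1` give `|X_{ab}| ≤ 1`. [cite: Kottwitz1986, §3] -/
theorem forall_v_le_one_of_forall_v_sub_smul_le {X : Matrix (Fin N) (Fin N) K} {c r : K} (hc : Valued.v c ≤ 1) (hr : Valued.v r ≤ 1)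
    (h : ∀ a b, Valued.v ((X - c • (1 : Matrix (Fin N) (Fin N) K)) a b) ≤ Valued.v r) : ∀ a b, Valued.v (X a b) ≤ 1 := by
  intro a b
  have h1 : X a b = (X - c • (1 : Matrix (Fin N) (Fin N) K)) a b + c * (1 : Matrix (Fin N) (Fin N) K) a b := by
    rw [Matrix.sub_apply, Matrix.smul_apply, smul_eq_mul]; ring
  rw [h1]
  refine (Valuation.map_add _ _ _).trans (max_le ((h a b).trans hr) ?_)
  rw [map_mul]
  refine mul_le_one' hc ?_
  by_cases hab : a = b
  · rw [hab, Matrix.one_apply_eq, map_one]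
  · rw [Matrix.one_apply_ne hab, map_zero]; exact zero_le_one

/-- The entrywise bound `|(Y − c·1)_{ab}| ≤ |r|` is invariant under `GL_N(𝒪)`-conjugation of `Y`. [cite: Kottwitz1986, §3] -/
theorem forall_v_conj_sub_smul_le_iff_of_mem_glInt [ValuativeRel K] [(Valued.v : Valuation K ℤᵐ⁰).Compatible] {k : GL (Fin N) K} (hk : k ∈ glInt N K)
    (Y : Matrix (Fin N) (Fin N) K) (c r : K) :
    (∀ a b, Valued.v ((((k : Matrix (Fin N) (Fin N) K)⁻¹ * Y * (k : Matrix (Fin N) (Fin N) K)) - c • (1 : Matrix (Fin N) (Fin N) K)) a b) ≤ Valued.v r) ↔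
      ∀ a b, Valued.v ((Y - c • (1 : Matrix (Fin N) (Fin N) K)) a b) ≤ Valued.v r := by
  obtain ⟨hki, hki'⟩ := (Literature.NumberTheory.Automorphic.mem_glInt_iff_forall_v_le_one k).1 hk
  have hkinv : (k : Matrix (Fin N) (Fin N) K)⁻¹ = (((k⁻¹ : GL (Fin N) K)) : Matrix (Fin N) (Fin N) K) := (Matrix.coe_units_inv k).symm
  have hconj : ((k : Matrix (Fin N) (Fin N) K)⁻¹ * Y * (k : Matrix (Fin N) (Fin N) K)) - c • (1 : Matrix (Fin N) (Fin N) K) =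
      (k : Matrix (Fin N) (Fin N) K)⁻¹ * (Y - c • (1 : Matrix (Fin N) (Fin N) K)) * (k : Matrix (Fin N) (Fin N) K) := by
    rw [Matrix.mul_sub, Matrix.sub_mul, Matrix.mul_smul, Matrix.smul_mul, Matrix.mul_one, Matrix.nonsing_inv_mul _ (Matrix.isUnits_det_units k)]
  -- an integral conjugation preserves entrywise bounds
  have bound : ∀ (P Q Z : Matrix (Fin N) (Fin N) K), (∀ a b, Valued.v (P a b) ≤ 1) → (∀ a b, Valued.v (Q a b) ≤ 1) →
      (∀ a b, Valued.v (Z a b) ≤ Valued.v r) → ∀ a b, Valued.v ((P * Z * Q) a b) ≤ Valued.v r := by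
    intro P Q Z hP hQ hZ a b
    rw [Matrix.mul_apply]
    refine Valuation.map_sum_le _ fun j _ => ?_
    rw [map_mul, Matrix.mul_apply]
    refine (mul_le_mul' (Valuation.map_sum_le _ fun i _ => ?_) (hQ j b)).trans (by rw [mul_one])
    rw [map_mul]
    exact (mul_le_mul' (hP a i) (hZ i j)).trans (by rw [one_mul])
  constructor
  · intro h
    have h' := bound (k : Matrix (Fin N) (Fin N) K) ((k : Matrix (Fin N) (Fin N) K)⁻¹) ((k : Matrix (Fin N) (Fin N) K)⁻¹ * (Y - c • (1 : Matrix (Fin N) (Fin N) K)) * (k : Matrix (Fin N) (Fin N) K))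
      hki (by rw [hkinv]; exact hki') (by rw [← hconj]; exact h)
    have e : (k : Matrix (Fin N) (Fin N) K) * ((k : Matrix (Fin N) (Fin N) K)⁻¹ * (Y - c • (1 : Matrix (Fin N) (Fin N) K)) * (k : Matrix (Fin N) (Fin N) K)) * (k : Matrix (Fin N) (Fin N) K)⁻¹ =
        Y - c • (1 : Matrix (Fin N) (Fin N) K) := by
      rw [Matrix.mul_assoc, Matrix.mul_assoc, Matrix.mul_nonsing_inv _ (Matrix.isUnits_det_units k), Matrix.mul_one,
        Matrix.mul_nonsing_inv_cancel_left _ _ (Matrix.isUnits_det_units k)]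
    rw [e] at h'
    exact h'
  · intro h
    rw [hconj]
    exact bound _ _ _ (by rw [hkinv]; exact hki') hki h

/-! ## §2 Centred versus plain tokens (`|c − 1|` small) -/

/-- **`LEV_{γ−c}(r) ⟺ LEV_{γ−1}(r)`** on any `𝒪`-lattice `M` when `|c − 1| ≤ |r|` (`r ≠ 0`): `γ − 1 = (γ − c·1) + (c − 1)·1` and `(c − 1)M ⊆ rM`.
[cite: Kottwitz1986, §3] [cite: Rogawski1990, §4.9 p. 55] -/
theorem map_sub_smul_one_le_scaleLattice_iff_map_sub_one_le (Γ : Matrix (Fin N) (Fin N) K) {c r : K} (hr : r ≠ 0) (hc : Valued.v (c - 1) ≤ Valued.v r)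
    (M : Submodule 𝒪[K] (Fin N → K)) :
    M.map ((Matrix.toLin' (Γ - c • (1 : Matrix (Fin N) (Fin N) K))).restrictScalars 𝒪[K]) ≤ scaleLattice r M ↔
      M.map ((Matrix.toLin' (Γ - 1)).restrictScalars 𝒪[K]) ≤ scaleLattice r M := by
  constructor
  · exact map_toLin'_le_scaleLattice_of_eq_smul_add_smul (A := Γ - c • (1 : Matrix (Fin N) (Fin N) K)) (s := 1) (t := c - 1)
      (by rw [one_smul, sub_smul, one_smul]; abel) (by rw [map_one]) hr hc M
  · exact map_toLin'_le_scaleLattice_of_eq_smul_add_smul (A := Γ - 1) (s := 1) (t := 1 - c)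
      (by rw [one_smul, sub_smul, one_smul]; abel) (by rw [map_one]) hr (by rw [← Valuation.map_neg, neg_sub]; exact hc) M

/-- `ϖ²M ⊆ ϖM`. [cite: Serre1980Trees, II.1.1] -/
theorem scaleLattice_sq_le_scaleLattice {ϖ : K} (hϖ1 : Valued.v ϖ ≤ 1) (M : Submodule 𝒪[K] (Fin N → K)) : scaleLattice (ϖ ^ 2) M ≤ scaleLattice ϖ M := by
  rw [pow_two, ← scaleLattice_scaleLattice]
  exact scaleLattice_mono ϖ (scaleLattice_le_self_of_v_le_one hϖ1 M)

/-- **ROW `0`: `LEV_{γ−c}(ϖ²) ⟺ LEV_{γ−1}(ϖ) ∧ LEV_{γ−1}(ϖ²)`** when `|c − 1| ≤ |ϖ²|` (the depth-`2` ball of (B-i) at `j = 1` is the axis label `0`).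
[cite: Kottwitz1986, §3] [cite: Rogawski1990, §4.9 p. 55] [cite: LabesseLanglands1979, §2 Lemma 2.1 p. 8] -/
theorem map_sub_smul_one_le_scaleLattice_sq_iff_lev_and_lev (Γ : Matrix (Fin N) (Fin N) K) {c ϖ : K} (hϖ0 : ϖ ≠ 0) (hϖ1 : Valued.v ϖ ≤ 1)
    (hc : Valued.v (c - 1) ≤ Valued.v (ϖ ^ 2)) (M : Submodule 𝒪[K] (Fin N → K)) :
    M.map ((Matrix.toLin' (Γ - c • (1 : Matrix (Fin N) (Fin N) K))).restrictScalars 𝒪[K]) ≤ scaleLattice (ϖ ^ 2) M ↔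
      (M.map ((Matrix.toLin' (Γ - 1)).restrictScalars 𝒪[K]) ≤ scaleLattice ϖ M ∧ M.map ((Matrix.toLin' (Γ - 1)).restrictScalars 𝒪[K]) ≤ scaleLattice (ϖ ^ 2) M) := by
  rw [map_sub_smul_one_le_scaleLattice_iff_map_sub_one_le Γ (pow_ne_zero 2 hϖ0) hc M]
  exact ⟨fun h => ⟨h.trans (scaleLattice_sq_le_scaleLattice hϖ1 M), h⟩, fun h => h.2⟩

/-- **`LEV₂`: `(γ − c·1)²M ⊆ ϖ³M ⟺ (γ − 1)²M ⊆ ϖ³M`** under `LEV_{γ−1}(ϖ)` and `|c − 1| ≤ |ϖ|²`. [cite: Kottwitz1986, §3] [cite: Rogawski1990, §4.9 p. 55] -/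
theorem map_sq_sub_smul_one_le_iff_map_sq_sub_one_le {ϖ : K} (hϖ : Valued.v ϖ = WithZero.exp (-1 : ℤ)) (Γ : Matrix (Fin N) (Fin N) K) {c : K}
    (hc : Valued.v (c - 1) ≤ Valued.v ϖ ^ 2) (M : Submodule 𝒪[K] (Fin N → K)) (hlev : M.map ((Matrix.toLin' (Γ - 1)).restrictScalars 𝒪[K]) ≤ scaleLattice ϖ M) :
    M.map ((Matrix.toLin' ((Γ - c • (1 : Matrix (Fin N) (Fin N) K)) ^ 2)).restrictScalars 𝒪[K]) ≤ scaleLattice (ϖ ^ 3) M ↔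
      M.map ((Matrix.toLin' ((Γ - 1) ^ 2)).restrictScalars 𝒪[K]) ≤ scaleLattice (ϖ ^ 3) M := by
  have hϖ0 : ϖ ≠ 0 := fun h0 => by rw [h0, map_zero] at hϖ; exact WithZero.coe_ne_zero hϖ.symm
  have hϖ1 : Valued.v ϖ ≤ 1 := by rw [hϖ, ← WithZero.exp_zero]; exact WithZero.exp_le_exp.2 (by norm_num)
  have hcϖ : Valued.v (c - 1) ≤ Valued.v ϖ := hc.trans (pow_le_of_le_one zero_le hϖ1 two_ne_zero)
  have hlev' : M.map ((Matrix.toLin' (Γ - c • (1 : Matrix (Fin N) (Fin N) K))).restrictScalars 𝒪[K]) ≤ scaleLattice ϖ M :=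
    (map_sub_smul_one_le_scaleLattice_iff_map_sub_one_le Γ hϖ0 hcϖ M).2 hlev
  constructor
  · exact map_toLin'_sq_le_scaleLattice_of_eq_smul_add_smul hϖ (A := Γ - c • (1 : Matrix (Fin N) (Fin N) K)) (s := 1) (t := c - 1)
      (by rw [one_smul, sub_smul, one_smul]; abel) (by rw [map_one]) hc M hlev'
  · exact map_toLin'_sq_le_scaleLattice_of_eq_smul_add_smul hϖ (A := Γ - 1) (s := 1) (t := 1 - c)
      (by rw [one_smul, sub_smul, one_smul]; abel) (by rw [map_one]) (by rw [← Valuation.map_neg, neg_sub]; exact hc) M hlev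

/-- From `|ϖ⁻¹P − C| < 1` and `|C| ≤ 1`: `|P| ≤ |ϖ|`. [cite: Rogawski1990, §4.9 p. 55] -/
theorem v_le_of_v_inv_mul_sub_lt_one {ϖ P C : K} (hϖ0 : ϖ ≠ 0) (h : Valued.v (ϖ⁻¹ * P - C) < 1) (hC : Valued.v C ≤ 1) : Valued.v P ≤ Valued.v ϖ := by
  have h1 : Valued.v (ϖ⁻¹ * P) ≤ 1 := by
    have := Valuation.map_add Valued.v (ϖ⁻¹ * P - C) C
    rw [sub_add_cancel] at this
    exact this.trans (max_le h.le hC)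
  have hvϖ : Valued.v ϖ ≠ 0 := (Valuation.ne_zero_iff _).2 hϖ0
  rw [map_mul, map_inv₀] at h1
  calc Valued.v P = Valued.v ϖ * (Valued.v ϖ)⁻¹ * Valued.v P := by rw [mul_inv_cancel₀ hvϖ, one_mul]
    _ ≤ Valued.v ϖ * 1 := by rw [mul_assoc]; exact mul_le_mul_right h1 _
    _ = Valued.v ϖ := mul_one _

/-- **`CLS_{γ−c}(c₀) ⟺ CLS_{γ−1}(c₀)`** on a vertex lattice `M` (`|⟨y,y⟩| ≤ 1` on `M`), `|c − 1| ≤ |ϖ|²`, `|c₀| ≤ 1`: `ϖ⁻¹⟨y,(γ−1)y⟩ = ϖ⁻¹⟨y,(γ−c)y⟩ + ϖ⁻¹(c−1)⟨y,y⟩`, the last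
term of absolute value `≤ |ϖ| < 1`. [cite: Rogawski1990, §4.9 p. 55] [cite: Kottwitz1986, §3] -/
theorem exists_mem_class_sub_smul_one_iff_exists_mem_class_sub_one {σ : K →+* K} (hvσ : ∀ a, Valued.v (σ a) = Valued.v a) {ϖ : K} (hϖ : Valued.v ϖ = WithZero.exp (-1 : ℤ))
    {H : Matrix (Fin N) (Fin N) K} {d : ℕ} {M : Submodule 𝒪[K] (Fin N → K)} (hM : IsVertexLattice σ ϖ H d M) (Γ : Matrix (Fin N) (Fin N) K) {c : K}
    (hc : Valued.v (c - 1) ≤ Valued.v ϖ ^ 2) {c₀ : K} (hc₀ : Valued.v c₀ ≤ 1) :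
    (∃ y ∈ M, ∃ a : K, Valued.v a = 1 ∧ Valued.v (ϖ⁻¹ * pairing σ H y ((Γ - c • (1 : Matrix (Fin N) (Fin N) K)) *ᵥ y) - c₀ * a ^ 2) < 1) ↔
      ∃ y ∈ M, ∃ a : K, Valued.v a = 1 ∧ Valued.v (ϖ⁻¹ * pairing σ H y ((Γ - 1) *ᵥ y) - c₀ * a ^ 2) < 1 := by
  have hϖ0 : ϖ ≠ 0 := fun h0 => by rw [h0, map_zero] at hϖ; exact WithZero.coe_ne_zero hϖ.symm
  have hC : ∀ a : K, Valued.v a = 1 → Valued.v (c₀ * a ^ 2) ≤ 1 := fun a ha => by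
    rw [map_mul, map_pow, ha, one_pow, mul_one]; exact hc₀
  have h11 : Valued.v ((1 : K) - 1) ≤ Valued.v ϖ ^ 2 := by rw [sub_self, map_zero]; exact zero_le
  refine exists_congr fun y => and_congr_right fun hy => exists_congr fun a => and_congr_right fun ha => ?_
  have hyy : Valued.v (pairing σ H y y) ≤ 1 := v_pairing_self_le_one hvσ hM hy
  constructor
  · intro h
    have hAy := v_le_of_v_inv_mul_sub_lt_one hϖ0 h (hC a ha)
    exact (v_inv_mul_pairing_sub_lt_one_iff_of_eq_smul_add_smul hϖ σ H (A := Γ - c • (1 : Matrix (Fin N) (Fin N) K)) (B := Γ - 1) (s := 1) (t := c - 1)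
      (by rw [one_smul, sub_smul, one_smul]; abel) h11 hc hAy hyy (c₀ * a ^ 2)).2 h
  · intro h
    have hAy := v_le_of_v_inv_mul_sub_lt_one hϖ0 h (hC a ha)
    exact (v_inv_mul_pairing_sub_lt_one_iff_of_eq_smul_add_smul hϖ σ H (A := Γ - 1) (B := Γ - c • (1 : Matrix (Fin N) (Fin N) K)) (s := 1) (t := 1 - c)
      (by rw [one_smul, sub_smul, one_smul]; abel) h11 (by rw [← Valuation.map_neg, neg_sub]; exact hc) hAy hyy (c₀ * a ^ 2)).2 h

/-! ## §3 The coset ↔ lattice dictionary at rank 2 -/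

/-- **THE DICTIONARY AT `J₂ = antidiag(1,1)`, `N = 2`, `|2| = 1`**: the two hypotheses of the master ★ `ncard_fixedBy_quotient_sep_eq_ncard_selfDual_fixed_sep` hold (★
`isSelfDualLattice_stdLattice_two_of_v`, ★ `exists_unitary_mapGL_stdLattice_eq_of_isSelfDualLattice_two_of_v_two`), so for `U = U(σ, J₂)(K)`, any isometric involution `σ`, every
`γ ∈ U` and labels `P ∕ Q` agreeing at `u⁻¹γu ∈ GL₂(𝒪)` ∕ `u·L₀`: `#{uK_U ∈ Fix_γ(U ⧸ K_U) : P(u⁻¹γu)} = #{B : B self-dual for J₂, γB = B, Q B}`.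
[cite: Kottwitz1986, §3] [cite: Rogawski1990, §4.9 p. 54] [cite: LabesseLanglands1979, §2 Lemma 2.1 p. 8] -/
theorem ncard_fixedBy_quotient_sep_eq_ncard_selfDual_fixed_sep_antidiagonal_two [ValuativeRel K] [(Valued.v : Valuation K ℤᵐ⁰).Compatible]
    {σ : K →+* K} (hσ : ∀ a, σ (σ a) = a) (hvσ : ∀ a, Valued.v (σ a) = Valued.v a)
    {ϖ : K} (hϖ : Valued.v ϖ = WithZero.exp (-1 : ℤ)) (h2 : Valued.v (2 : K) = 1)
    (γ : ↥(unitaryGroupOfForm σ ((StdForm.antidiagonal 2).over K))) (P : ↥(unitaryGroupOfForm σ ((StdForm.antidiagonal 2).over K)) → Prop) (Q : Submodule (Valued.integer K) (Fin 2 → K) → Prop)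
    (hPQ : ∀ g : ↥(unitaryGroupOfForm σ ((StdForm.antidiagonal 2).over K)), ((g⁻¹ * γ * g : ↥(unitaryGroupOfForm σ ((StdForm.antidiagonal 2).over K))) : GL (Fin 2) K) ∈ glInt 2 K →
      (P (g⁻¹ * γ * g) ↔ Q (mapGL ((g : ↥(unitaryGroupOfForm σ ((StdForm.antidiagonal 2).over K))) : GL (Fin 2) K) (stdLattice K 2)))) :
    {q : ↥(unitaryGroupOfForm σ ((StdForm.antidiagonal 2).over K)) ⧸ (glInt 2 K).subgroupOf (unitaryGroupOfForm σ ((StdForm.antidiagonal 2).over K)) |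
        q ∈ MulAction.fixedBy (↥(unitaryGroupOfForm σ ((StdForm.antidiagonal 2).over K)) ⧸ (glInt 2 K).subgroupOf (unitaryGroupOfForm σ ((StdForm.antidiagonal 2).over K))) γ ∧
          P (q.out⁻¹ * γ * q.out)}.ncard =
      {M : Submodule (Valued.integer K) (Fin 2 → K) | IsSelfDualLattice σ ϖ ((StdForm.antidiagonal 2).over K) M ∧
        mapGL ((γ : ↥(unitaryGroupOfForm σ ((StdForm.antidiagonal 2).over K))) : GL (Fin 2) K) M = M ∧ Q M}.ncard :=
  ncard_fixedBy_quotient_sep_eq_ncard_selfDual_fixed_sep σ ϖ _ (isSelfDualLattice_stdLattice_two_of_v hϖ)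
    (fun _ hM => exists_unitary_mapGL_stdLattice_eq_of_isSelfDualLattice_two_of_v_two hσ hvσ hϖ h2 hM) γ P Q hPQ

end Literature.NumberTheory.Automorphic.UnitaryLatticeTree

end
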